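import Summits.SmoothPoincare4.SmoothPoincare4.Theorems.SymplecticOrigamiGromovRecognitionRelEndStubPositiveHolonomyAux3
import Mathlib.Geometry.Manifold.VectorBundle.Hom

/-!
# Positive holonomy for `GromovRecognitionRelEnd` — local constancy of the sign and the one-sided
theorem (stub `stub_positiveHolonomy` of line `cross-cap-laurent`, crux
`SymplecticOrigami.GromovRecognitionRelEnd`, item stmt-SmoothPoincare4-11009; fourth auxiliary file)

* `continuousAt_holonomyForm` — along the moving frame `v(y) = A_y⁻¹ V` of the chart at `y₁`
  (`tangentCoordChange`), the holonomy form `y ↦ dx₀∧dx₁ (dℓ_y v(y), dℓ_y (J_y v(y)))` is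
  continuous at `y₁`: `dℓ` and `J` read in the chart at `y₁` (`inTangentCoordinates`) are continuous
  there (`ContMDiffAt.mfderiv_const`, `contMDiffAt_hom_bundle`);
* `eventually_pos_iff` — hence the orientation clause ("positive holonomy at `y`") is locally
  constant in `y`;
* `pos_holonomy_oneSided` — **the one-sided theorem**: on a connected `X`, a `C^∞` map `λ` into
  `H∞` with flat charts everywhere, `J`-invariant kernels transverse to those of a second such map
  `λ'`, and restricting to the identity on the axis of one holomorphic chart, satisfies the
  orientation clause `dλ (J v) = α dλ v + β J (dλ v)`, `β > 0`, at every point (the set where it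
  holds is clopen and contains the axis point).
-/

noncomputable section

-- the registered namespace `Summit.SmoothPoincare4.SmoothPoincare4.Theorems…` repeats a component
set_option linter.dupNamespace false

open scoped Manifold ContDiff Topology
open Set Function Filter Bundle Literature.Geometry.Symplectic

namespace Summit.SmoothPoincare4.SmoothPoincare4.Theorems.GromovRecognitionRelEnd.CrossCapLaurent

namespace PosHolonomy

open CapModel FlatLeaves

variable {X : Type*} [TopologicalSpace X] [ChartedSpace (EuclideanSpace ℝ (Fin 4)) X]
  [IsManifold (𝓡 4) ∞ X] (JX : AlmostComplexStructure (𝓡 4) ∞ X)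

/-! ## `J` and `dℓ` read in the chart at `y₁` -/

/-- **`J` read in the chart at `y₁` is continuous at `y₁`** (the coordinate expression of the
smooth section `J` of `End(TX)`, `contMDiffAt_hom_bundle`). [folklore] -/
theorem continuousAt_J_inChart (y₁ : X) :
    ContinuousAt (inTangentCoordinates (𝓡 4) (𝓡 4) id id
      (fun y => (JX y : EuclideanSpace ℝ (Fin 4) →L[ℝ] EuclideanSpace ℝ (Fin 4))) y₁) y₁ := by
  have h := (contMDiffAt_hom_bundle (IB := 𝓡 4) (n := ∞) (F₁ := EuclideanSpace ℝ (Fin 4))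
    (F₂ := EuclideanSpace ℝ (Fin 4)) (E₁ := (TangentSpace (𝓡 4) : X → Type _))
    (E₂ := (TangentSpace (𝓡 4) : X → Type _))
    (fun y : X ↦ TotalSpace.mk' (EuclideanSpace ℝ (Fin 4) →L[ℝ] EuclideanSpace ℝ (Fin 4)) y
      (JX y : TangentSpace (𝓡 4) y →L[ℝ] TangentSpace (𝓡 4) y)) (x₀ := y₁)).1 (JX.contMDiff' y₁)
  exact h.2.continuousAt

/-- Over the chart domain of `y₁`: `Ĵ(y) w = A_y (J_y (A_y⁻¹ w))` with the tangent coordinate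
changes `A_y = τ_{y → y₁}`, `A_y⁻¹ = τ_{y₁ → y}`. [folklore] -/
theorem J_inChart_apply {y₁ y : X} (hy : y ∈ (chartAt (EuclideanSpace ℝ (Fin 4)) y₁).source)
    (w : EuclideanSpace ℝ (Fin 4)) :
    inTangentCoordinates (𝓡 4) (𝓡 4) id id
        (fun y => (JX y : EuclideanSpace ℝ (Fin 4) →L[ℝ] EuclideanSpace ℝ (Fin 4))) y₁ y w =
      tangentCoordChange (𝓡 4) y y₁ y (JX y (tangentCoordChange (𝓡 4) y₁ y y w)) := by
  rw [inTangentCoordinates_eq _ _ _ hy hy]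
  rfl

/-- `A_y⁻¹ (A_y w) = w` over the chart domain of `y₁`. [folklore] -/
theorem tangentCoordChange_cancel {y₁ y : X}
    (hy : y ∈ (chartAt (EuclideanSpace ℝ (Fin 4)) y₁).source) (w : EuclideanSpace ℝ (Fin 4)) :
    tangentCoordChange (𝓡 4) y₁ y y (tangentCoordChange (𝓡 4) y y₁ y w) = w := by
  have hy' : y ∈ (extChartAt (𝓡 4) y₁).source := by rwa [extChartAt_source]
  have hyy : y ∈ (extChartAt (𝓡 4) y).source := mem_extChartAt_source y
  rw [tangentCoordChange_comp ⟨⟨hyy, hy'⟩, hyy⟩, tangentCoordChange_self hyy]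

/-- **`dℓ` read in the chart at `y₁` is continuous at `y₁`** for `ℓ : X → ℝ⁴` smooth at `y₁`
(`ContMDiffAt.mfderiv_const`). [folklore] -/
theorem continuousAt_mfderiv_inChart {ℓ : X → EuclideanSpace ℝ (Fin 4)} {y₁ : X}
    (hℓ : ContMDiffAt (𝓡 4) 𝓘(ℝ, EuclideanSpace ℝ (Fin 4)) ∞ ℓ y₁) :
    ContinuousAt (inTangentCoordinates (𝓡 4) 𝓘(ℝ, EuclideanSpace ℝ (Fin 4)) id ℓ
      (fun y => (mfderiv (𝓡 4) 𝓘(ℝ, EuclideanSpace ℝ (Fin 4)) ℓ y :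
        EuclideanSpace ℝ (Fin 4) →L[ℝ] EuclideanSpace ℝ (Fin 4))) y₁) y₁ :=
  (hℓ.mfderiv_const (m := 0) (by simp)).continuousAt

/-- Over the chart domain of `y₁`: `dℓ` read in the chart is `dℓ_y ∘ A_y⁻¹` (the target `ℝ⁴` is
its own chart). [folklore] -/
theorem mfderiv_inChart_apply {ℓ : X → EuclideanSpace ℝ (Fin 4)} {y₁ y : X}
    (hy : y ∈ (chartAt (EuclideanSpace ℝ (Fin 4)) y₁).source)
    (ϕ : X → EuclideanSpace ℝ (Fin 4) →L[ℝ] EuclideanSpace ℝ (Fin 4)) (w : EuclideanSpace ℝ (Fin 4)) :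
    inTangentCoordinates (𝓡 4) 𝓘(ℝ, EuclideanSpace ℝ (Fin 4)) id ℓ ϕ y₁ y w =
      ϕ y (tangentCoordChange (𝓡 4) y₁ y y w) := by
  have hy' : ℓ y ∈ (chartAt (EuclideanSpace ℝ (Fin 4)) (ℓ y₁)).source := by simp
  rw [inTangentCoordinates_eq _ _ _ hy hy', tangentBundleCore_coordChange_model_space]
  rfl

/-- `dx₀∧dx₁` is continuous on `ℝ⁴ × ℝ⁴`. [folklore] -/
theorem continuous_ar01 : Continuous fun ab : EuclideanSpace ℝ (Fin 4) × EuclideanSpace ℝ (Fin 4) =>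
    ar01 ab.1 ab.2 := by
  have hc : ∀ i : Fin 4, Continuous fun x : EuclideanSpace ℝ (Fin 4) => x i :=
    fun i => (contDiff_coord i).continuous
  simp only [ar01_def]
  exact (((hc 0).comp continuous_fst).mul ((hc 1).comp continuous_snd)).sub
    (((hc 1).comp continuous_fst).mul ((hc 0).comp continuous_snd))

/-- **Continuity of the holonomy form along the moving frame.** For `ℓ : X → ℝ⁴` smooth at `y₁`
and `V ∈ ℝ⁴`, the function `y ↦ dx₀∧dx₁ (L̂(y) V, L̂(y) (Ĵ(y) V))` — `L̂`, `Ĵ` the chart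
expressions of `dℓ`, `J` at `y₁` — is continuous at `y₁`. [folklore] -/
theorem continuousAt_holonomyForm {ℓ : X → EuclideanSpace ℝ (Fin 4)} {y₁ : X}
    (hℓ : ContMDiffAt (𝓡 4) 𝓘(ℝ, EuclideanSpace ℝ (Fin 4)) ∞ ℓ y₁) (V : EuclideanSpace ℝ (Fin 4)) :
    ContinuousAt (fun y => ar01
      (inTangentCoordinates (𝓡 4) 𝓘(ℝ, EuclideanSpace ℝ (Fin 4)) id ℓ
        (fun y => (mfderiv (𝓡 4) 𝓘(ℝ, EuclideanSpace ℝ (Fin 4)) ℓ y :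
          EuclideanSpace ℝ (Fin 4) →L[ℝ] EuclideanSpace ℝ (Fin 4))) y₁ y V)
      (inTangentCoordinates (𝓡 4) 𝓘(ℝ, EuclideanSpace ℝ (Fin 4)) id ℓ
        (fun y => (mfderiv (𝓡 4) 𝓘(ℝ, EuclideanSpace ℝ (Fin 4)) ℓ y :
          EuclideanSpace ℝ (Fin 4) →L[ℝ] EuclideanSpace ℝ (Fin 4))) y₁ y
        (inTangentCoordinates (𝓡 4) (𝓡 4) id id
          (fun y => (JX y : EuclideanSpace ℝ (Fin 4) →L[ℝ] EuclideanSpace ℝ (Fin 4))) y₁ y V))) y₁ := by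
  have hΦ := continuousAt_mfderiv_inChart hℓ
  have hJ := continuousAt_J_inChart JX y₁
  have ha := hΦ.clm_apply (continuousAt_const (y := V))
  have hb := hΦ.clm_apply (hJ.clm_apply (continuousAt_const (y := V)))
  exact continuous_ar01.continuousAt.comp (ha.prodMk hb)

/-! ## Local constancy of the sign -/

variable {lam : X → X} {η : EuclideanSpace ℝ (Fin 4) → X} {D : Set (EuclideanSpace ℝ (Fin 4))}
  {N : Set X} (hlam : ContMDiff (𝓡 4) (𝓡 4) ∞ lam)
  (hD : IsOpen D) (hη : IsLocalDiffeomorphOn 𝓘(ℝ, EuclideanSpace ℝ (Fin 4)) (𝓡 4) ∞ η D)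
  (hinj : InjOn η D)
  (hhol : ∀ p ∈ D, ∀ q : EuclideanSpace ℝ (Fin 4),
    JX (η p) (mfderiv 𝓘(ℝ, EuclideanSpace ℝ (Fin 4)) (𝓡 4) η p q) =
      mfderiv 𝓘(ℝ, EuclideanSpace ℝ (Fin 4)) (𝓡 4) η p (I4 q))
  (hN : IsOpen N) (hflat : ∀ y ∈ N, ∃ p ∈ D, p 2 = 0 ∧ p 3 = 0 ∧ η p = lam y)

include hlam hD hη hinj hhol hN hflat in
/-- **The orientation clause is locally constant in the base point.** In a flat chart around `y₁`
(kernels of `dλ` `J`-invariant, `dλ_{y₁} ≠ 0`), positive holonomy at `y` is equivalent to positive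
holonomy at `y₁` for all `y` near `y₁`: transport `V ∉ ker dλ_{y₁}` along the chart frame, the
holonomy form along it is continuous and non-zero, so keeps its sign, and the sign at a point does
not depend on the vector. [folklore] -/
theorem eventually_pos_iff {y₁ : X} (hy₁ : y₁ ∈ N)
    (hJV : ∀ (y : X) (v : TangentSpace (𝓡 4) y), mfderiv (𝓡 4) (𝓡 4) lam y v = 0 →
      mfderiv (𝓡 4) (𝓡 4) lam y (JX y v) = 0)
    (hex : ∃ v : TangentSpace (𝓡 4) y₁, mfderiv (𝓡 4) (𝓡 4) lam y₁ v ≠ 0) :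
    ∀ᶠ y in 𝓝 y₁,
      (∀ v : TangentSpace (𝓡 4) y, mfderiv (𝓡 4) (𝓡 4) lam y v ≠ 0 →
        ∃ α β : ℝ, 0 < β ∧ mfderiv (𝓡 4) (𝓡 4) lam y (JX y v) =
          α • mfderiv (𝓡 4) (𝓡 4) lam y v + β • JX (lam y) (mfderiv (𝓡 4) (𝓡 4) lam y v)) ↔
      (∀ v : TangentSpace (𝓡 4) y₁, mfderiv (𝓡 4) (𝓡 4) lam y₁ v ≠ 0 →
        ∃ α β : ℝ, 0 < β ∧ mfderiv (𝓡 4) (𝓡 4) lam y₁ (JX y₁ v) =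
          α • mfderiv (𝓡 4) (𝓡 4) lam y₁ v + β • JX (lam y₁) (mfderiv (𝓡 4) (𝓡 4) lam y₁ v)) := by
  obtain ⟨V, hV⟩ := hex
  have hℓ : ContMDiffAt (𝓡 4) 𝓘(ℝ, EuclideanSpace ℝ (Fin 4)) ∞ (invFunOn η D ∘ lam) y₁ :=
    contMDiffAt_invChart hD hη hinj hflat hlam hy₁
  -- the chart expressions of `dℓ` and `J` at `y₁`, and the holonomy form along the frame
  set Φc : X → EuclideanSpace ℝ (Fin 4) →L[ℝ] EuclideanSpace ℝ (Fin 4) :=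
    inTangentCoordinates (𝓡 4) 𝓘(ℝ, EuclideanSpace ℝ (Fin 4)) id (invFunOn η D ∘ lam)
      (fun y => (mfderiv (𝓡 4) 𝓘(ℝ, EuclideanSpace ℝ (Fin 4)) (invFunOn η D ∘ lam) y :
        EuclideanSpace ℝ (Fin 4) →L[ℝ] EuclideanSpace ℝ (Fin 4))) y₁ with hΦc
  set Jc : X → EuclideanSpace ℝ (Fin 4) →L[ℝ] EuclideanSpace ℝ (Fin 4) :=
    inTangentCoordinates (𝓡 4) (𝓡 4) id id
      (fun y => (JX y : EuclideanSpace ℝ (Fin 4) →L[ℝ] EuclideanSpace ℝ (Fin 4))) y₁ with hJc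
  set F : X → ℝ := fun y => ar01 (Φc y V) (Φc y (Jc y V)) with hF
  have hFc : ContinuousAt F y₁ := continuousAt_holonomyForm JX hℓ V
  -- the chart identities at a point of the chart domain
  have hsrc₁ : y₁ ∈ (chartAt (EuclideanSpace ℝ (Fin 4)) y₁).source := mem_chart_source _ y₁
  have hident : ∀ {y : X}, y ∈ (chartAt (EuclideanSpace ℝ (Fin 4)) y₁).source →
      ∀ {L Jy : EuclideanSpace ℝ (Fin 4) →L[ℝ] EuclideanSpace ℝ (Fin 4)},
      L = mfderiv (𝓡 4) 𝓘(ℝ, EuclideanSpace ℝ (Fin 4)) (invFunOn η D ∘ lam) y → Jy = JX y →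
      F y = ar01 (L (tangentCoordChange (𝓡 4) y₁ y y V))
        (L (Jy (tangentCoordChange (𝓡 4) y₁ y y V))) := by
    intro y hy L Jy hL hJy
    have h1 : Φc y V = L (tangentCoordChange (𝓡 4) y₁ y y V) := by
      rw [hΦc, mfderiv_inChart_apply hy, hL]
    have h2 : Jy (tangentCoordChange (𝓡 4) y₁ y y V) = tangentCoordChange (𝓡 4) y₁ y y (Jc y V) := by
      rw [hJc, J_inChart_apply JX hy, tangentCoordChange_cancel hy, hJy]
      rfl
    have h3 : Φc y (Jc y V) = L (Jy (tangentCoordChange (𝓡 4) y₁ y y V)) := by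
      rw [h2, hΦc, mfderiv_inChart_apply hy, hL]
    show ar01 (Φc y V) (Φc y (Jc y V)) = _
    rw [h1, h3]
  -- at `y₁` the form is non-zero
  obtain ⟨L₁, hL₁⟩ : ∃ L₁ : EuclideanSpace ℝ (Fin 4) →L[ℝ] EuclideanSpace ℝ (Fin 4),
      L₁ = mfderiv (𝓡 4) 𝓘(ℝ, EuclideanSpace ℝ (Fin 4)) (invFunOn η D ∘ lam) y₁ := ⟨_, rfl⟩
  obtain ⟨J₁, hJ₁⟩ : ∃ J₁ : EuclideanSpace ℝ (Fin 4) →L[ℝ] EuclideanSpace ℝ (Fin 4),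
      J₁ = JX y₁ := ⟨_, rfl⟩
  obtain ⟨Lam₁, hLam₁⟩ : ∃ Lam₁ : EuclideanSpace ℝ (Fin 4) →L[ℝ] EuclideanSpace ℝ (Fin 4),
      Lam₁ = mfderiv (𝓡 4) (𝓡 4) lam y₁ := ⟨_, rfl⟩
  have hV₁ : tangentCoordChange (𝓡 4) y₁ y₁ y₁ V = V :=
    tangentCoordChange_self (mem_extChartAt_source y₁)
  have hzero₁ : ∀ w, Lam₁ w = 0 ↔ L₁ w = 0 :=
    mfderiv_eq_zero_iff_invChart hD hη hinj hflat hlam hN hy₁ hLam₁ hL₁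
  have hLV : L₁ V ≠ 0 := by
    intro h
    apply hV
    have := (hzero₁ V).2 h
    subst hLam₁
    exact this
  have hpl₁ : ∀ w, L₁ w 2 = 0 ∧ L₁ w 3 = 0 :=
    mfderiv_invChart_plane hD hη hinj hflat hlam hN hy₁ hL₁
  have hJJ₁ : ∀ w, J₁ (J₁ w) = -w := by
    subst hJ₁
    exact fun w => JX.map_map y₁ w
  have hker₁ : ∀ w, L₁ w = 0 → L₁ (J₁ w) = 0 := by
    intro w hw
    have h1 : Lam₁ w = 0 := (hzero₁ w).2 hw
    have h2 : Lam₁ (J₁ w) = 0 := by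
      subst hLam₁ hJ₁
      exact hJV y₁ w h1
    exact (hzero₁ _).1 h2
  have hF₁ : F y₁ = ar01 (L₁ V) (L₁ (J₁ V)) := by
    rw [hident hsrc₁ hL₁ hJ₁, hV₁]
  have hFne : F y₁ ≠ 0 := by
    rw [hF₁]
    exact ar01_ne_zero hJJ₁ hpl₁ hker₁ hLV
  -- the sign of `F` is locally constant near `y₁`
  have hsign : ∀ᶠ y in 𝓝 y₁, (0 < F y ↔ 0 < F y₁) ∧ F y ≠ 0 := by
    rcases lt_or_gt_of_ne hFne with hneg | hpos
    · filter_upwards [hFc.eventually_mem (Iio_mem_nhds hneg)] with y hy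
      exact ⟨iff_of_false (not_lt.2 (le_of_lt hy)) (not_lt.2 hneg.le), ne_of_lt hy⟩
    · filter_upwards [hFc.eventually_mem (Ioi_mem_nhds hpos)] with y hy
      exact ⟨iff_of_true hy hpos, ne_of_gt hy⟩
  have hchart : ∀ᶠ y in 𝓝 y₁, y ∈ (chartAt (EuclideanSpace ℝ (Fin 4)) y₁).source :=
    (chartAt _ y₁).open_source.mem_nhds hsrc₁
  filter_upwards [hsign, hchart, hN.mem_nhds hy₁] with y hs hyc hyN
  -- at such a `y`, read both sides through the holonomy form
  obtain ⟨L, hL⟩ : ∃ L : EuclideanSpace ℝ (Fin 4) →L[ℝ] EuclideanSpace ℝ (Fin 4),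
      L = mfderiv (𝓡 4) 𝓘(ℝ, EuclideanSpace ℝ (Fin 4)) (invFunOn η D ∘ lam) y := ⟨_, rfl⟩
  obtain ⟨Jy, hJy⟩ : ∃ Jy : EuclideanSpace ℝ (Fin 4) →L[ℝ] EuclideanSpace ℝ (Fin 4),
      Jy = JX y := ⟨_, rfl⟩
  have hFy := hident hyc hL hJy
  have hv₀ : L (tangentCoordChange (𝓡 4) y₁ y y V) ≠ 0 := by
    intro h0
    apply hs.2
    rw [hFy, h0, ar01_def]
    simp
  rw [pos_iff_ar01_pos JX hlam hD hη hinj hhol hN hflat hyN (hJV y) hL hJy hv₀,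
    pos_iff_ar01_pos JX hlam hD hη hinj hhol hN hflat hy₁ (hJV y₁) hL₁ hJ₁ hLV, ← hFy, ← hF₁]
  exact hs.1

/-! ## The one-sided theorem -/

omit hlam hD hη hinj hhol hN hflat

/-- **Positive holonomy, one side.** Let `X` be a connected `4`-manifold with almost complex
structure `J`, `λ, λ' : X → X` two `C^∞` maps admitting flat charts (along the axis plane
`{p₂ = p₃ = 0}` of injective holomorphic local diffeomorphisms) around every point, with
`ker dλ` `J`-invariant and `ker dλ ∩ ker dλ' = 0`, and suppose `λ` restricts to the identity on
the axis `η₀ (P01 ℝ⁴)` of a holomorphic chart `η₀` with `0 ∈ D₀`.  Then for every `y` and every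
`v` with `dλ v ≠ 0` there are `α` and `β > 0` with `dλ (J v) = α dλ v + β J_{λ y} (dλ v)`: the set of
points with positive holonomy is open and closed (`eventually_pos_iff`, using `dλ ≠ 0` everywhere,
`exists_mfderiv_ne_zero`), and contains the axis point `η₀ 0` (`pos_at_axis`). [folklore] -/
theorem pos_holonomy_oneSided [ConnectedSpace X] {lam lam' : X → X}
    (hlam : ContMDiff (𝓡 4) (𝓡 4) ∞ lam) (hlam' : ContMDiff (𝓡 4) (𝓡 4) ∞ lam')
    (HF : ∀ y₀ : X, ∃ (η : EuclideanSpace ℝ (Fin 4) → X) (D : Set (EuclideanSpace ℝ (Fin 4)))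
      (N : Set X), IsOpen D ∧ IsLocalDiffeomorphOn 𝓘(ℝ, EuclideanSpace ℝ (Fin 4)) (𝓡 4) ∞ η D ∧
      InjOn η D ∧
      (∀ p ∈ D, ∀ q : EuclideanSpace ℝ (Fin 4),
        JX (η p) (mfderiv 𝓘(ℝ, EuclideanSpace ℝ (Fin 4)) (𝓡 4) η p q) =
          mfderiv 𝓘(ℝ, EuclideanSpace ℝ (Fin 4)) (𝓡 4) η p (I4 q)) ∧
      IsOpen N ∧ y₀ ∈ N ∧ ∀ y ∈ N, ∃ p ∈ D, p 2 = 0 ∧ p 3 = 0 ∧ η p = lam y)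
    (HF' : ∀ y₀ : X, ∃ (η : EuclideanSpace ℝ (Fin 4) → X) (D : Set (EuclideanSpace ℝ (Fin 4)))
      (N : Set X), IsOpen D ∧ IsLocalDiffeomorphOn 𝓘(ℝ, EuclideanSpace ℝ (Fin 4)) (𝓡 4) ∞ η D ∧
      InjOn η D ∧
      (∀ p ∈ D, ∀ q : EuclideanSpace ℝ (Fin 4),
        JX (η p) (mfderiv 𝓘(ℝ, EuclideanSpace ℝ (Fin 4)) (𝓡 4) η p q) =
          mfderiv 𝓘(ℝ, EuclideanSpace ℝ (Fin 4)) (𝓡 4) η p (I4 q)) ∧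
      IsOpen N ∧ y₀ ∈ N ∧ ∀ y ∈ N, ∃ p ∈ D, p 2 = 0 ∧ p 3 = 0 ∧ η p = lam' y)
    (hJV : ∀ (y : X) (v : TangentSpace (𝓡 4) y), mfderiv (𝓡 4) (𝓡 4) lam y v = 0 →
      mfderiv (𝓡 4) (𝓡 4) lam y (JX y v) = 0)
    (htr : ∀ (y : X) (v : TangentSpace (𝓡 4) y), mfderiv (𝓡 4) (𝓡 4) lam y v = 0 →
      mfderiv (𝓡 4) (𝓡 4) lam' y v = 0 → v = 0)
    {η₀ : EuclideanSpace ℝ (Fin 4) → X} {D₀ : Set (EuclideanSpace ℝ (Fin 4))} (hD₀ : IsOpen D₀)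
    (hη₀ : IsLocalDiffeomorphOn 𝓘(ℝ, EuclideanSpace ℝ (Fin 4)) (𝓡 4) ∞ η₀ D₀) (hinj₀ : InjOn η₀ D₀)
    (hhol₀ : ∀ p ∈ D₀, ∀ q : EuclideanSpace ℝ (Fin 4),
      JX (η₀ p) (mfderiv 𝓘(ℝ, EuclideanSpace ℝ (Fin 4)) (𝓡 4) η₀ p q) =
        mfderiv 𝓘(ℝ, EuclideanSpace ℝ (Fin 4)) (𝓡 4) η₀ p (I4 q))
    (h0 : (0 : EuclideanSpace ℝ (Fin 4)) ∈ D₀)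
    (hret : ∀ q : EuclideanSpace ℝ (Fin 4), lam (η₀ (P01 q)) = η₀ (P01 q)) :
    ∀ (y : X) (v : TangentSpace (𝓡 4) y), mfderiv (𝓡 4) (𝓡 4) lam y v ≠ 0 →
      ∃ α β : ℝ, 0 < β ∧ mfderiv (𝓡 4) (𝓡 4) lam y (JX y v) =
        α • mfderiv (𝓡 4) (𝓡 4) lam y v + β • JX (lam y) (mfderiv (𝓡 4) (𝓡 4) lam y v) := by
  -- `dλ ≠ 0` everywhere
  have hex : ∀ y : X, ∃ v : TangentSpace (𝓡 4) y, mfderiv (𝓡 4) (𝓡 4) lam y v ≠ 0 := by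
    intro y
    obtain ⟨η', D', N', hD', hη', hinj', -, hN', hy, hflat'⟩ := HF' y
    exact exists_mfderiv_ne_zero hlam' hD' hη' hinj' hN' hflat' hy (htr y)
  -- the set of points with positive holonomy is clopen
  set P : Set X := {y | ∀ v : TangentSpace (𝓡 4) y, mfderiv (𝓡 4) (𝓡 4) lam y v ≠ 0 →
      ∃ α β : ℝ, 0 < β ∧ mfderiv (𝓡 4) (𝓡 4) lam y (JX y v) =
        α • mfderiv (𝓡 4) (𝓡 4) lam y v + β • JX (lam y) (mfderiv (𝓡 4) (𝓡 4) lam y v)} with hP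
  have hloc : ∀ y₁ : X, ∀ᶠ y in 𝓝 y₁, (y ∈ P ↔ y₁ ∈ P) := by
    intro y₁
    obtain ⟨η, D, N, hD, hη, hinj, hhol, hN, hy₁, hflat⟩ := HF y₁
    exact eventually_pos_iff JX hlam hD hη hinj hhol hN hflat hy₁ hJV (hex y₁)
  have hopen : IsOpen P :=
    isOpen_iff_mem_nhds.2 fun y₁ hy₁ => (hloc y₁).mono fun y h => h.2 hy₁
  have hclosed : IsClosed P := by
    refine ⟨isOpen_iff_mem_nhds.2 fun y₁ hy₁ => (hloc y₁).mono fun y h hy => hy₁ (h.1 hy)⟩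
  -- and contains the axis point `η₀ (P01 0)`
  have hmem : η₀ (P01 0) ∈ P := by
    obtain ⟨v, hv, hw⟩ := pos_at_axis JX hlam hD₀ hη₀ hhol₀ hinj₀ h0 hret
    obtain ⟨η, D, N, hD, hη, hinj, hhol, hN, hy, hflat⟩ := HF (η₀ (P01 0))
    obtain ⟨L, hL⟩ : ∃ L : EuclideanSpace ℝ (Fin 4) →L[ℝ] EuclideanSpace ℝ (Fin 4),
        L = mfderiv (𝓡 4) 𝓘(ℝ, EuclideanSpace ℝ (Fin 4)) (invFunOn η D ∘ lam) (η₀ (P01 0)) :=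
      ⟨_, rfl⟩
    obtain ⟨Lam, hLam⟩ : ∃ Lam : EuclideanSpace ℝ (Fin 4) →L[ℝ] EuclideanSpace ℝ (Fin 4),
        Lam = mfderiv (𝓡 4) (𝓡 4) lam (η₀ (P01 0)) := ⟨_, rfl⟩
    obtain ⟨Jy, hJy⟩ : ∃ Jy : EuclideanSpace ℝ (Fin 4) →L[ℝ] EuclideanSpace ℝ (Fin 4),
        Jy = JX (η₀ (P01 0)) := ⟨_, rfl⟩
    obtain ⟨Jh, hJh⟩ : ∃ Jh : EuclideanSpace ℝ (Fin 4) →L[ℝ] EuclideanSpace ℝ (Fin 4),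
        Jh = JX (lam (η₀ (P01 0))) := ⟨_, rfl⟩
    have hLv : L v ≠ 0 := by
      intro h0
      apply hv
      have h1 := (mfderiv_eq_zero_iff_invChart hD hη hinj hflat hlam hN hy hLam hL v).2 h0
      subst hLam
      exact h1
    have hw' : ∃ α β : ℝ, 0 < β ∧ Lam (Jy v) = α • Lam v + β • Jh (Lam v) := by
      subst hLam hJy hJh
      exact hw
    have hpos : 0 < ar01 (L v) (L (Jy v)) :=
      (exists_pos_iff_ar01_pos JX hlam hD hη hinj hhol hN hflat hy hLam hL hJh hLv _).1 hw'
    exact (pos_iff_ar01_pos JX hlam hD hη hinj hhol hN hflat hy (hJV _) hL hJy hLv).2 hpos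
  have hP' : P = univ := by
    rcases isClopen_iff.1 ⟨hclosed, hopen⟩ with h | h
    · exact absurd hmem (by rw [h]; exact notMem_empty _)
    · exact h
  intro y
  have hy : y ∈ P := by rw [hP']; exact mem_univ y
  exact hy

end PosHolonomy

/-- **Registered helper sub-goal `helper_positiveHolonomyJChartContinuous`** (fourth auxiliary file
of stub `stub_positiveHolonomy`): the coordinate expression of a `C^∞` almost complex structure in the
chart at `y₁` is continuous at `y₁`. [folklore] -/
theorem helper_positiveHolonomyJChartContinuous : ∀ (X : Type) [TopologicalSpace X]
    [ChartedSpace (EuclideanSpace ℝ (Fin 4)) X] [IsManifold (𝓡 4) ∞ X]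
    (JX : Literature.Geometry.Symplectic.AlmostComplexStructure (𝓡 4) ∞ X) (y₁ : X),
    ContinuousAt (inTangentCoordinates (𝓡 4) (𝓡 4) id id
      (fun y => (JX y : EuclideanSpace ℝ (Fin 4) →L[ℝ] EuclideanSpace ℝ (Fin 4))) y₁) y₁ :=
  fun _ _ _ _ JX y₁ => PosHolonomy.continuousAt_J_inChart JX y₁

end Summit.SmoothPoincare4.SmoothPoincare4.Theorems.GromovRecognitionRelEnd.CrossCapLaurent

end
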